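import Mathlib
import Summits.KontsevichZagierPeriods.Zeta5Search.RecordRayLevels
import Summits.KontsevichZagierPeriods.Zeta5Search.LawA3Proof
import HarnessLib

/-!
# ζ(5) search — CLASS TYPE COVERS V: the second-order law A3 (census letter I) from a type cover (p3 g6)

HONEST FRAMING: systematic search; no irrationality claim unless certified.  Cell `pub-zeta5`, prover seat p3, generation 6.

`SecondOrder.LawA3` (`lawA3_holds`, gen-2 g10 / typer): in regime H0 with the deep classes all of ONE palindromic type `T`
(non-self-conjugate) and the sub-deep pole classes single raises of `T` (or the odd-centre class of type `T`),
`v_p(Cas_j(b)) ≥ 6 − 2M` (`= casLB + 3`).  All four class hypotheses read the class data through the level type, so a COVER of the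
residues (`ClassTypeCover.Cover`) and the decidable check `checkI` give them scale-free (`lawA3_of_cover`, any `b`; no class has to
be realised); `record_I` is the record-ray window wrapper (`c ≤ 6 − 2M`).  Valuations of rationals; every kernel exponent these
feed stays `< 1` — no irrationality content.
-/

noncomputable section

open Finset

namespace Summit.KontsevichZagierPeriods.Zeta5Search.ClassTypeCover

open Summit.KontsevichZagierPeriods.Zeta5Search.ClusterValuation
open Summit.KontsevichZagierPeriods.Zeta5Search.CasoratianValuation (InPolytope shift casoratian)
open Summit.KontsevichZagierPeriods.Zeta5Search.WedgeDictionary (dOf)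
open Summit.KontsevichZagierPeriods.Zeta5Search.SecondOrder (classTypeList isRaise LawA3 lawA3_holds)

variable {p : ℕ}

/-- Check of the four class hypotheses of `LawA3` at depth `M` with the deep type `T`. -/
def checkI (odd : Bool) (TY : List (List ℤ × Bool)) (M : ℕ) (T : List ℤ) : Bool :=
  TY.all fun tc =>
    (decide (polesL tc.1 < 2) || decide (-(M : ℤ) ≤ expL odd tc.1 tc.2)) &&
    (!decide (polesL tc.1 = 1) || decide (-(M : ℤ) + 1 ≤ nuL odd tc.1 tc.2)) &&
    (!(decide (2 ≤ polesL tc.1) && decide (expL odd tc.1 tc.2 = -(M : ℤ))) || (!tc.2 && decide (tc.1 = T))) &&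
    (!(decide (1 ≤ polesL tc.1) && decide (nuL odd tc.1 tc.2 = -(M : ℤ) + 1)) ||
      (isRaise T tc.1 || (odd && tc.2 && decide (tc.1 = T))))

/-- **LAW A3 from a cover**: `6 − 2M ≤ v_p(Cas_j(b))`. -/
theorem lawA3_of_cover {b : ℕ → ℤ} {j : ℕ} (hb : InPolytope b) (hb' : InPolytope (shift b j)) (hj1 : 1 ≤ j) (hj7 : j ≤ 7)
    (hpr : p.Prime) (hp5 : 5 ≤ p) (hpb : (p : ℤ) ≤ b 0) (hwin : (b 0 + 2 : ℤ) < (p : ℤ) ^ 2)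
    {TY : List (List ℤ × Bool)} (hcov : Cover b p TY) {M : ℕ} (hM : 6 ≤ M) (hMe : Even M) {T : List ℤ} (hT : T.reverse = T)
    (hchk : checkI (decide (¬ (2 : ℤ) ∣ b 0)) TY M T = true) (hcas : casoratian b j ≠ 0) :
    (6 : ℤ) - 2 * M ≤ padicValRat p (casoratian b j) := by
  haveI : Fact p.Prime := ⟨hpr⟩
  rw [checkI, List.all_eq_true] at hchk
  refine lawA3_holds b p j M T hb hb' hj1 hj7 hpr hp5 hpb hwin hM hMe hT ?_ ?_ ?_ ?_ hcas
  · intro x hxm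
    obtain ⟨hx, h2⟩ := (mem_multipoleClasses_iff b p x).1 hxm
    obtain ⟨tc, htc, ht⟩ := hcov x hx
    have hc := hchk tc htc
    simp only [Bool.and_eq_true, Bool.or_eq_true, decide_eq_true_eq] at hc
    rw [ht.classPoleCount_eq] at h2
    rw [ht.classExp_eq]
    rcases hc.1.1.1 with h | h
    · omega
    · exact h
  · intro y hy h1
    obtain ⟨tc, htc, ht⟩ := hcov y hy
    have hc := hchk tc htc
    simp only [Bool.and_eq_true, Bool.or_eq_true, Bool.not_eq_true', decide_eq_false_iff_not, decide_eq_true_eq] at hc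
    rw [ht.classPoleCount_eq] at h1
    rw [ht.classNu_eq]
    rcases hc.1.1.2 with h | h
    · exact absurd h1 h
    · exact h
  · intro x hxm hE
    obtain ⟨hx, h2⟩ := (mem_multipoleClasses_iff b p x).1 hxm
    obtain ⟨tc, htc, ht⟩ := hcov x hx
    have hc := hchk tc htc
    simp only [Bool.and_eq_true, Bool.or_eq_true, Bool.not_eq_true', Bool.and_eq_false_iff, decide_eq_false_iff_not,
      decide_eq_true_eq] at hc
    rw [ht.classPoleCount_eq] at h2
    rw [ht.classExp_eq] at hE
    rcases hc.1.2 with (h | h) | ⟨hc1, hc2⟩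
    · omega
    · exact absurd hE h
    · refine ⟨fun hcen => ?_, by rw [ht.classTypeList_eq]; exact hc2⟩
      rw [ht.cen_iff.1 hcen] at hc1
      exact Bool.noConfusion hc1
  · intro y hy h1 hnu
    obtain ⟨tc, htc, ht⟩ := hcov y hy
    have hc := hchk tc htc
    simp only [Bool.and_eq_true, Bool.or_eq_true, Bool.not_eq_true', Bool.and_eq_false_iff, decide_eq_false_iff_not,
      decide_eq_true_eq] at hc
    rw [ht.classPoleCount_eq] at h1
    rw [ht.classNu_eq] at hnu
    rcases hc.2 with (h | h) | (h | ⟨⟨ho, hc1⟩, hc2⟩)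
    · omega
    · exact absurd hnu h
    · left; rw [ht.classTypeList_eq]; exact h
    · right
      exact ⟨ho, ht.cen_iff.2 hc1, by rw [ht.classTypeList_eq]; exact hc2⟩

/-- **RECORD WINDOW BOUND by LAW A3**: `c ≤ v_p(Cas₇(b(n)))` from a cover and `checkI` (`M ≥ 6` even, `T` palindromic, `c ≤ 6 − 2M`). -/
theorem record_I {n : ℕ} (hn : 1 ≤ n) (hpr : p.Prime) (hp5 : 5 ≤ p) (hpd : p ≤ 25 * n) (hsq : 41 * n + 2 < p ^ 2)
    {r : ℕ} (hr : n % 2 = r) {TY : List (List ℤ × Bool)} (hcov : Cover (bRec n) p TY) {M : ℕ} (hM : 6 ≤ M) (hMe : Even M)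
    {T : List ℤ} (hT : T.reverse = T) (hI : checkI (decide (r = 1)) TY M T = true) {c : ℤ} (hc : c ≤ 6 - 2 * M)
    (hne : casoratian (bRec n) 7 ≠ 0) : c ≤ padicValRat p (casoratian (bRec n) 7) := by
  obtain ⟨hpb, -, hwin⟩ := rec_window (n := n) hpd hsq
  have h := lawA3_of_cover (inPolytope_bRec n) (inPolytope_shift_bRec n 7 hn (by norm_num) (by norm_num)) (by norm_num)
    (by norm_num) hpr hp5 hpb hwin hcov hM hMe hT (by rw [oddFlag_bRec n hr]; exact hI) hne
  linarith

end Summit.KontsevichZagierPeriods.Zeta5Search.ClassTypeCover
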